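import Literature.Topology.FourManifolds.NormalRetraction
import Literature.AlgebraicTopology.Homotopy.NeighbourhoodRetract
import Mathlib.Geometry.Manifold.WhitneyEmbedding
import Mathlib.Analysis.InnerProductSpace.PiL2
import HarnessLib

/-!
# Compact smooth manifolds are Euclidean neighbourhood retracts (Hatcher, Cor. A.9, smooth case, proved)

Topic `Literature/Topology/FourManifolds`, next to `NormalRetraction.lean`. Hatcher, *Algebraic
Topology* (2002), Appendix, Cor. A.9 (p. 527): "A compact manifold, with or without boundary,
is an ENR." The tree vendors the topological route to this (Thm. A.7, local contractibility ⇒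
neighbourhood retract, named fact `Literature.AlgebraicTopology.Homotopy.isNeighbourhoodRetract_of_locallyContractibleSpace`,
file `Literature/AlgebraicTopology/Homotopy/NeighbourhoodRetract.lean`). For *smooth* compact
boundaryless manifolds the statement is PROVED here unconditionally, by the classical smooth
argument (Hirsch, *Differential Topology* (1976), Ch. 4 §5, Thm. 5.1–5.2; Milnor–Stasheff /
Bredon II.11.14): embed `M ↪ ℝᴺ` by Whitney's theorem (Mathlib,
`exists_embedding_euclidean_of_compact`) and retract an open tube onto the image along the
normals (tree theorem `Literature.Topology.FourManifolds.exists_normalRetraction`, `NormalRetraction.lean`).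

* `Literature.Topology.FourManifolds.exists_euclidean_retract`: a nonempty compact smooth `n`-manifold `M` admits
  `j : M → ℝᴺ` continuous (indeed the Whitney embedding), an open `W ⊇ j(M)` and `r` continuous
  on `W` with `r (j x) = x` for all `x`.
* `Literature.Topology.FourManifolds.exists_euclidean_retract_of_retract`: the same for any retract `A` of an open subset
  `U ⊆ M` (e.g. the complement of an open disc, a retract of the complement of its centre).
* `Literature.Topology.FourManifolds.exists_isEmbedding_isNeighbourhoodRetract_range`: in the language of
  `NeighbourhoodRetract.lean`, some embedding `j : M → (Fin N → ℝ)` has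
  `IsNeighbourhoodRetract (range j)` — Hatcher's Cor. A.9 for compact smooth manifolds, with no
  named-fact hypothesis.

These feed the contractibility of weakly contractible compact neighbourhood retracts
(cubical extension lemma, Hatcher Lemma 4.7 / Prop. A.11) in the proof that punctured homotopy
spheres are contractible (`Literature.Topology.FourManifolds.HomotopySphere.contractibleSpace_compl_image_ball`,
Kosinski 1993, VI §1). No declaration here uses `sorry` or a named fact.

## References

* A. Hatcher, *Algebraic Topology*, CUP (2002), Appendix, Cor. A.9 (p. 527). [HatcherAT2002]
* M. W. Hirsch, *Differential Topology*, GTM 33, Springer (1976), Ch. 4 §5, Thm. 5.1–5.2.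
  [HirschDT1976]
-/

open scoped Manifold ContDiff
open Set Function _root_.Topology

noncomputable section

namespace Literature.Topology.FourManifolds

/-- **A compact smooth manifold is a Euclidean neighbourhood retract** (Hatcher 2002, Cor. A.9,
smooth boundaryless case; Hirsch 1976, Ch. 4 §5): by Whitney's embedding theorem
(`exists_embedding_euclidean_of_compact`) and the smooth normal retraction of a tube
(`Literature.Topology.FourManifolds.exists_normalRetraction`) there are `N`, a continuous `j : M → ℝᴺ`, an open
`W ⊇ j(M)` and `r` continuous on `W` with `r (j x) = x`. [cite: HatcherAT2002, Appendix Cor. A.9] [cite: HirschDT1976, Ch. 4 §5 Thm. 5.1–5.2] -/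
theorem exists_euclidean_retract (n : ℕ) (M : Type*) [TopologicalSpace M] [T2Space M]
    [CompactSpace M] [Nonempty M] [ChartedSpace (EuclideanSpace ℝ (Fin n)) M] [IsManifold (𝓡 n) ∞ M] :
    ∃ (N : ℕ) (j : M → EuclideanSpace ℝ (Fin N)) (W : Set (EuclideanSpace ℝ (Fin N))) (r : EuclideanSpace ℝ (Fin N) → M), IsClosedEmbedding j ∧ IsOpen W ∧
      (∀ x, j x ∈ W) ∧ ContinuousOn r W ∧ ∀ x, r (j x) = x := by
  obtain ⟨N, e, he, hemb, hinj⟩ := exists_embedding_euclidean_of_compact (I := 𝓡 n) (M := M)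
  obtain ⟨ε, hε, hopen, hsmooth, hret⟩ :=
    exists_normalRetraction (I := 𝓡 n) he hemb.injective hinj
  have h0 : ∀ x : M, e x ∈ normalTube (𝓡 n) e ε ∧ normalRetraction (𝓡 n) e ε (e x) = x :=
    fun x => by
      simpa using hret x 0 (Submodule.zero_mem _) (by simpa using hε)
  exact ⟨N, e, normalTube (𝓡 n) e ε, normalRetraction (𝓡 n) e ε, hemb, hopen,
    fun x => (h0 x).1, hsmooth.continuousOn, fun x => (h0 x).2⟩

/-- **Retracts of open subsets of compact smooth manifolds are Euclidean neighbourhood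
retracts**: if `A ⊆ U ⊆ M` with `U` open, `A` nonempty and `ρ : U → A` a retraction, then there
are `j : A → ℝᴺ` (an embedding), an open `W ⊇ j(A)` and `r` continuous on `W` with `r ∘ j = id`
(restrict the neighbourhood retraction of `M` to the preimage of `U` and follow it by `ρ`).
[cite: HatcherAT2002, Appendix Cor. A.9] -/
theorem exists_euclidean_retract_of_retract (n : ℕ) {M : Type*} [TopologicalSpace M] [T2Space M]
    [CompactSpace M] [ChartedSpace (EuclideanSpace ℝ (Fin n)) M] [IsManifold (𝓡 n) ∞ M] {U A : Set M}
    (hU : IsOpen U) (hAU : A ⊆ U) (hA : A.Nonempty) (ρ : C(↥U, ↥A))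
    (hρ : ∀ a : ↥A, ρ ⟨a, hAU a.2⟩ = a) :
    ∃ (N : ℕ) (j : ↥A → EuclideanSpace ℝ (Fin N)) (W : Set (EuclideanSpace ℝ (Fin N))) (r : EuclideanSpace ℝ (Fin N) → ↥A), IsEmbedding j ∧ IsOpen W ∧
      (∀ a, j a ∈ W) ∧ ContinuousOn r W ∧ ∀ a, r (j a) = a := by
  classical
  haveI : Nonempty M := ⟨hA.some⟩
  haveI : Nonempty ↥A := hA.to_subtype
  obtain ⟨N, j, W, r, hj, hW, hjW, hr, hrj⟩ := exists_euclidean_retract n M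
  have hW'o : IsOpen (W ∩ r ⁻¹' U) := hr.isOpen_inter_preimage hW hU
  let r' : EuclideanSpace ℝ (Fin N) → ↥A := fun y => if h : r y ∈ U then ρ ⟨r y, h⟩ else Classical.arbitrary ↥A
  have hjU : ∀ a : ↥A, r (j a) ∈ U := fun a => by
    rw [hrj]
    exact hAU a.2
  refine ⟨N, fun a => j a, W ∩ r ⁻¹' U, r', hj.isEmbedding.comp IsEmbedding.subtypeVal, hW'o,
    fun a => ⟨hjW a, hjU a⟩, ?_, fun a => ?_⟩
  · rw [continuousOn_iff_continuous_restrict]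
    have hrc : Continuous ((W ∩ r ⁻¹' U).restrict r) :=
      continuousOn_iff_continuous_restrict.1 (hr.mono inter_subset_left)
    have key : (W ∩ r ⁻¹' U).restrict r' = fun y : ↥(W ∩ r ⁻¹' U) => ρ ⟨r y, y.2.2⟩ :=
      funext fun y => dif_pos y.2.2
    rw [key]
    exact ρ.continuous.comp (hrc.subtype_mk fun y => y.2.2)
  · show (if h : r (j a) ∈ U then ρ ⟨r (j a), h⟩ else Classical.arbitrary ↥A) = a
    rw [dif_pos (hjU a)]
    have : (⟨r (j a), hjU a⟩ : ↥U) = ⟨a, hAU a.2⟩ := Subtype.ext (hrj a)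
    rw [this, hρ]

/-- **Hatcher's Cor. A.9 for compact smooth manifolds, unconditionally**: a compact smooth
boundaryless `n`-manifold `M` embeds in some `ℝᴺ = Fin N → ℝ` with image a neighbourhood
retract in the sense of `Literature.AlgebraicTopology.Homotopy.IsNeighbourhoodRetract` (compare
`Literature.AlgebraicTopology.Homotopy.isNeighbourhoodRetract_range_of_compactSpace`, which derives this for every
embedding of a compact topological manifold from the named fact Thm. A.7).
[cite: HatcherAT2002, Appendix Cor. A.9] -/
theorem exists_isEmbedding_isNeighbourhoodRetract_range (n : ℕ) (M : Type*) [TopologicalSpace M]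
    [T2Space M] [CompactSpace M] [ChartedSpace (EuclideanSpace ℝ (Fin n)) M] [IsManifold (𝓡 n) ∞ M] :
    ∃ (N : ℕ) (j : M → (Fin N → ℝ)), IsClosedEmbedding j ∧
      Literature.AlgebraicTopology.Homotopy.IsNeighbourhoodRetract (range j) := by
  classical
  cases isEmpty_or_nonempty M with
  | inl hM =>
    refine ⟨0, fun x => hM.elim x, ?_, ∅, isOpen_empty, ?_, ?_⟩
    · exact ⟨IsEmbedding.of_subsingleton _, by
        rw [range_eq_empty]
        exact isClosed_empty⟩
    · rintro _ ⟨x, -⟩; exact hM.elim x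
    · exact ⟨⟨fun y => y.1, continuous_subtype_val⟩, fun y => y.2.elim, fun y => y.2.elim⟩
  | inr hM =>
    obtain ⟨N, j, W, r, hj, hW, hjW, hr, hrj⟩ := exists_euclidean_retract n M
    set L := EuclideanSpace.equiv (Fin N) ℝ with hL
    refine ⟨N, fun x => L (j x), L.toHomeomorph.isClosedEmbedding.comp hj, L.symm ⁻¹' W,
      hW.preimage L.symm.continuous, ?_, ?_⟩
    · rintro _ ⟨x, rfl⟩
      show L.symm (L (j x)) ∈ W
      rw [ContinuousLinearEquiv.symm_apply_apply]
      exact hjW x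
    · refine ⟨⟨fun y => L (j (r (L.symm y))), ?_⟩, fun y => ⟨r (L.symm y), rfl⟩, ?_⟩
      · exact L.continuous.comp (hj.continuous.comp
          (hr.comp_continuous (L.symm.continuous.comp continuous_subtype_val) fun y => y.2))
      · rintro ⟨_, hy⟩ ⟨x, rfl⟩
        show L (j (r (L.symm (L (j x))))) = L (j x)
        rw [ContinuousLinearEquiv.symm_apply_apply, hrj]

end Literature.Topology.FourManifolds

end
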